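import Summits.ValiantsHypothesis.ValiantsHypothesis.Theorems.KPlusLogSqLawTropicalBToeplitzAffineWrap

/-!
# Route `KPlusLogSqLaw`, crux `TropicalB` — linear Toeplitz instances: the penalty toolkit of the regime method

HONEST FRAMING.  Helper toward the registered stubs `stub_tropThin` / `stub_tropFat` of
`Cruxes/TropicalB/Lines/birth.lean` (crux `Summit.ValiantsHypothesis.ValiantsHypothesis.Theses.KPlusLogSqLaw.TropicalB`,
ledger item `stmt-ValiantsHypothesis-19771`, route `KPlusLogSqLaw`; cell `pub-symmetroid`, seat `val-sym-trop-p3`,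
2026-08-26).  The three reusable bricks of the REGIME METHOD used inline in `…ToeplitzUnitRegime` (the `(1, −1)` regime),
stated once for successors attacking further rounding regimes of the cell's Conjecture T (desk R1448 (a) «next pair(s)»).
Nothing here bounds `Φ`, `TropicalB`, `KPlusLogSqLaw`, `MatrixDescartes` or anything about `VP ≠ VNP`.

* `toeplitz_penalty_identity` — with a Lagrangian triple `(L, Λ, Mx)` and `pen δ = Mx − (L·w_θ(δ) − Λ·δ)`:
  `L·W_θ(σ) + Σ_b pen(σ b − b) = m·Mx` for every permutation (displacements sum to `0`).
* `toeplitz_opt_pen_lt_of_pair` — DOMINATION: if `τ` is the unique maximiser among admissible permutations (`L > 0`) and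
  `σ₁ ≠ σ₂` are admissible with the same total penalty, then `Pen(τ) < Pen(σ₁)`.
* `toeplitz_opt_pen_apply_lt` — hence, when penalties are nonnegative on entries (the regime inequality `L·w − Λδ ≤ Mx`),
  EVERY displacement `d` of `τ` has `pen d < Pen(σ₁)`: equal-penalty competitor pairs forbid expensive displacements.

References: folklore (Lagrangian penalties); `sum_displacement_eq_zero` (`…ToeplitzAffineWrap`); the worked instance
`toeplitz_unitRegime_opt_eq_rotation` (`…ToeplitzUnitRegime`).
-/

set_option linter.dupNamespace false
set_option autoImplicit false

namespace Summit.ValiantsHypothesis.ValiantsHypothesis.Theorems.KPlusLogSqLaw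

open scoped BigOperators
open Finset

section Penalty

variable {m : ℕ}

/-- **Penalty identity.**  For every permutation `σ` of `Fin m` and every Lagrangian triple `(L, Λ, Mx)`:
`L · Σ_b (θ ψ(σ b − b) + α(σ b − b)) + Σ_b (Mx − (L·(θ ψ + α)(σ b − b) − Λ·(σ b − b))) = m · Mx`. [folklore] -/
theorem toeplitz_penalty_identity (ψ α : ℤ → ℤ) (θ L Λ Mx : ℤ) (σ : Equiv.Perm (Fin m)) :
    L * ∑ b, (θ * ψ ((σ b : ℤ) - b) + α ((σ b : ℤ) - b)) +
      ∑ b, (Mx - (L * (θ * ψ ((σ b : ℤ) - b) + α ((σ b : ℤ) - b)) - Λ * ((σ b : ℤ) - b))) = (m : ℤ) * Mx := by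
  have h0 := sum_displacement_eq_zero σ
  have e : ∑ b, (Mx - (L * (θ * ψ ((σ b : ℤ) - b) + α ((σ b : ℤ) - b)) - Λ * ((σ b : ℤ) - b))) =
      ∑ _b : Fin m, Mx - L * ∑ b, (θ * ψ ((σ b : ℤ) - b) + α ((σ b : ℤ) - b)) + Λ * ∑ b, ((σ b : ℤ) - b) := by
    rw [mul_sum, mul_sum, ← sum_sub_distrib, ← sum_add_distrib]
    exact sum_congr rfl fun b _ => by ring
  rw [e, h0, mul_zero, add_zero, sum_const, card_univ, Fintype.card_fin, nsmul_eq_mul]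
  ring

/-- **Domination by an equal-penalty pair.**  Let `τ` be the unique maximiser of `W_θ` among admissible permutations and
`L > 0`.  If two DISTINCT admissible permutations `σ₁ ≠ σ₂` have the same total penalty, then the total penalty of `τ` is
strictly smaller: `Pen(τ) < Pen(σ₁)` (one of them differs from `τ`, and `L·W + Pen` is constant). [folklore] -/
theorem toeplitz_opt_pen_lt_of_pair (ψ α : ℤ → ℤ) (P : ℤ → Prop) (θ L Λ Mx : ℤ) (hL : 0 < L)
    (τ : Equiv.Perm (Fin m))
    (huniq : ∀ σ : Equiv.Perm (Fin m), σ ≠ τ → (∀ b, P ((σ b : ℤ) - b)) →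
      ∑ b, (θ * ψ ((σ b : ℤ) - b) + α ((σ b : ℤ) - b)) < ∑ b, (θ * ψ ((τ b : ℤ) - b) + α ((τ b : ℤ) - b)))
    (σ₁ σ₂ : Equiv.Perm (Fin m)) (hne : σ₁ ≠ σ₂) (h₁ : ∀ b, P ((σ₁ b : ℤ) - b)) (h₂ : ∀ b, P ((σ₂ b : ℤ) - b))
    (heq : ∑ b, (Mx - (L * (θ * ψ ((σ₁ b : ℤ) - b) + α ((σ₁ b : ℤ) - b)) - Λ * ((σ₁ b : ℤ) - b))) =
      ∑ b, (Mx - (L * (θ * ψ ((σ₂ b : ℤ) - b) + α ((σ₂ b : ℤ) - b)) - Λ * ((σ₂ b : ℤ) - b)))) :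
    ∑ b, (Mx - (L * (θ * ψ ((τ b : ℤ) - b) + α ((τ b : ℤ) - b)) - Λ * ((τ b : ℤ) - b))) <
      ∑ b, (Mx - (L * (θ * ψ ((σ₁ b : ℤ) - b) + α ((σ₁ b : ℤ) - b)) - Λ * ((σ₁ b : ℤ) - b))) := by
  have iτ := toeplitz_penalty_identity ψ α θ L Λ Mx τ
  have i₁ := toeplitz_penalty_identity ψ α θ L Λ Mx σ₁
  have i₂ := toeplitz_penalty_identity ψ α θ L Λ Mx σ₂
  by_cases hσ₁ : σ₁ = τ
  · subst hσ₁
    have hlt := mul_lt_mul_of_pos_left (huniq σ₂ (Ne.symm hne) h₂) hL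
    linarith
  · have hlt := mul_lt_mul_of_pos_left (huniq σ₁ hσ₁ h₁) hL
    linarith

/-- **Equal-penalty pairs forbid expensive displacements.**  In the situation of `toeplitz_opt_pen_lt_of_pair`, if in
addition the penalty is nonnegative on all entries (the regime inequality `L·w_θ(a − b) − Λ(a − b) ≤ Mx`), then every single
displacement of `τ` has penalty strictly below the competitors' common total penalty. [folklore] -/
theorem toeplitz_opt_pen_apply_lt (ψ α : ℤ → ℤ) (P : ℤ → Prop) (θ L Λ Mx : ℤ) (hL : 0 < L)
    (hmax : ∀ a b : Fin m, L * (θ * ψ ((a : ℤ) - b) + α ((a : ℤ) - b)) - Λ * ((a : ℤ) - b) ≤ Mx)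
    (τ : Equiv.Perm (Fin m))
    (huniq : ∀ σ : Equiv.Perm (Fin m), σ ≠ τ → (∀ b, P ((σ b : ℤ) - b)) →
      ∑ b, (θ * ψ ((σ b : ℤ) - b) + α ((σ b : ℤ) - b)) < ∑ b, (θ * ψ ((τ b : ℤ) - b) + α ((τ b : ℤ) - b)))
    (σ₁ σ₂ : Equiv.Perm (Fin m)) (hne : σ₁ ≠ σ₂) (h₁ : ∀ b, P ((σ₁ b : ℤ) - b)) (h₂ : ∀ b, P ((σ₂ b : ℤ) - b))
    (heq : ∑ b, (Mx - (L * (θ * ψ ((σ₁ b : ℤ) - b) + α ((σ₁ b : ℤ) - b)) - Λ * ((σ₁ b : ℤ) - b))) =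
      ∑ b, (Mx - (L * (θ * ψ ((σ₂ b : ℤ) - b) + α ((σ₂ b : ℤ) - b)) - Λ * ((σ₂ b : ℤ) - b))))
    (b₀ : Fin m) :
    Mx - (L * (θ * ψ ((τ b₀ : ℤ) - b₀) + α ((τ b₀ : ℤ) - b₀)) - Λ * ((τ b₀ : ℤ) - b₀)) <
      ∑ b, (Mx - (L * (θ * ψ ((σ₁ b : ℤ) - b) + α ((σ₁ b : ℤ) - b)) - Λ * ((σ₁ b : ℤ) - b))) := by
  have hlt := toeplitz_opt_pen_lt_of_pair ψ α P θ L Λ Mx hL τ huniq σ₁ σ₂ hne h₁ h₂ heq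
  have hge : Mx - (L * (θ * ψ ((τ b₀ : ℤ) - b₀) + α ((τ b₀ : ℤ) - b₀)) - Λ * ((τ b₀ : ℤ) - b₀)) ≤
      ∑ b, (Mx - (L * (θ * ψ ((τ b : ℤ) - b) + α ((τ b : ℤ) - b)) - Λ * ((τ b : ℤ) - b))) :=
    single_le_sum (f := fun b => Mx - (L * (θ * ψ ((τ b : ℤ) - b) + α ((τ b : ℤ) - b)) - Λ * ((τ b : ℤ) - b)))
      (fun b _ => by have := hmax (τ b) b; linarith) (mem_univ b₀)
  exact lt_of_le_of_lt hge hlt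

end Penalty

end Summit.ValiantsHypothesis.ValiantsHypothesis.Theorems.KPlusLogSqLaw
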